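import Literature.Analysis.DeBrangesSpaces.HalfPlaneCauchy
import Literature.NumberTheory.Automorphic.FuchsianEisensteinFunctionalEquation
import Literature.NumberTheory.LFunctions.PolyaSignChangesMomentDefs

/-!
# Pólya's sign-change theorem (Grosswald 1967, Theorem B) — PieceB, auxiliary lemmas on poles of
# the continuation

Topic `Literature/NumberTheory/LFunctions` (namespace `Literature.NumberTheory.LFunctions`, grouping
sub-namespace `PolyaSignChanges`).  Part of the moment-method proof of the named fact
`Grosswald1967_thmB` (architecture: `PolyaSignChangesMomentDefs`; PieceB main file:
`PolyaSignChangesNearestPole`, `PolyaSignChangesInfiniteHeight`).  This module collects the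
complex-analytic lemmas behind the *nearest-pole* construction of PieceB, all standard:

* §A `isPreconnected_ball_diff_of_countable` — an open ball of `ℂ` minus a countable set is
  preconnected (homeomorphism `univBall` + `Set.Countable.isPathConnected_compl_of_one_lt_rank`);
* §B the reflection `s ↦ conj (N (conj s))` (tree lemma `AnalyticAt.conj_conj'`, reused);
* §C `mellinIoi_conj` — real symmetry `F(s̄) = conj F(s)` of `F = Landau.mellinIoi g` (`g` real);
* §D `finite_compact_nonanalytic` — a meromorphic function has finitely many non-analytic points in a
  compact subset of its domain;
* §E `subsingleton_equidist`, `exists_generic_real` — two distinct non-conjugate points are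
  equidistant from at most one real point, so finitely many points admit generic real centres;
* §F normal-form bookkeeping (`toMeromorphicNFOn_apply_of_analyticAt`, `analyticAt_toMeromorphicNFOn`,
  `toMeromorphicNFOn_pole`) and `exists_pole_near_line`: under the hypotheses of Theorem B the
  normal form of `Φ` has a pole in every strip `{θ − η₁ < re}` (else `F` would continue past `θ`);
* §G `not_analyticAt_conj_of_pole` — for `N` real-symmetric on `ball λ R`, the conjugate of a pole
  on the circle `|s − λ| = R` is a pole (identity theorem on a punctured disc + orders);
* §H two pieces of real arithmetic (`height_bound_of_nearer`, `ref_pole_in_disc`; the identity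
  `‖x − w‖² = (x − re w)² + (im w)²` is the tree lemma `DeBrangesSpaces.norm_ofReal_sub_sq`).

Nothing in this file bears on the truth of RH; no summit statement is proved here.
[cite: Grosswald1967, §4 Thm B pp. 4–5]
-/

noncomputable section

open Complex Set MeasureTheory Filter Topology Metric
open scoped ComplexConjugate

namespace Literature.NumberTheory.LFunctions.PolyaSignChanges

/-! ### A. Connectivity: a ball minus a countable set is preconnected -/

/-- In `ℂ`, an open ball with a countable set removed is preconnected.
(auxiliary step of the proof of Theorem B). [cite: Grosswald1967, §4 Thm B pp. 4–5] -/
theorem isPreconnected_ball_diff_of_countable (c : ℂ) (r : ℝ) {T : Set ℂ} (hT : T.Countable) :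
    IsPreconnected (ball c r \ T) := by
  rcases le_or_gt r 0 with hr | hr
  · rw [Metric.ball_eq_empty.2 hr, Set.empty_sdiff]
    exact isPreconnected_empty
  set e := OpenPartialHomeomorph.univBall c r with he
  have hsrc : e.source = univ := OpenPartialHomeomorph.univBall_source c r
  have htgt : e.target = ball c r := OpenPartialHomeomorph.univBall_target c hr
  have hinj : Function.Injective e := by
    rw [← Set.injOn_univ, ← hsrc]; exact e.injOn
  set S : Set ℂ := e ⁻¹' T with hS
  have hSc : S.Countable := hT.preimage hinj
  have hrank : 1 < Module.rank ℝ ℂ := by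
    simp only [Complex.rank_real_complex, Nat.one_lt_ofNat]
  have hpc : IsPathConnected Sᶜ := hSc.isPathConnected_compl_of_one_lt_rank hrank
  have himage : e '' Sᶜ = ball c r \ T := by
    ext y
    constructor
    · rintro ⟨z, hz, rfl⟩
      refine ⟨?_, hz⟩
      rw [← htgt]
      exact e.map_source (by rw [hsrc]; exact mem_univ _)
    · rintro ⟨hy, hyT⟩
      refine ⟨e.symm y, ?_, ?_⟩
      · show e (e.symm y) ∉ T
        rw [e.right_inv (by rw [htgt]; exact hy)]
        exact hyT
      · exact e.right_inv (by rw [htgt]; exact hy)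
  rw [← himage]
  exact (hpc.image' (f := e)
    ((OpenPartialHomeomorph.continuous_univBall c r).continuousOn)).isConnected.isPreconnected

/-! ### B. Reflection `s ↦ conj (N (conj s))`: see `AnalyticAt.conj_conj'`
(`Literature/NumberTheory/Automorphic/FuchsianEisensteinFunctionalEquation.lean`). -/

/-! ### C. Real symmetry of the transform -/

/-- For real `g`, `F(s̄) = conj F(s)` where `F = Landau.mellinIoi g`.
(auxiliary step of the proof of Theorem B). [cite: Grosswald1967, §4 Thm B pp. 4–5] -/
theorem mellinIoi_conj (g : ℝ → ℝ) (s : ℂ) :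
    Landau.mellinIoi g (conj s) = conj (Landau.mellinIoi g s) := by
  unfold Landau.mellinIoi
  rw [← integral_conj]
  refine setIntegral_congr_fun measurableSet_Ioi fun x hx => ?_
  have hx0 : 0 < x := zero_lt_one.trans hx
  have harg : (x : ℂ).arg ≠ Real.pi := by
    rw [Complex.arg_ofReal_of_nonneg hx0.le]; exact Real.pi_pos.ne
  simp only [map_mul, Complex.conj_ofReal]
  congr 1
  have : -(conj s + 1) = conj (-(s + 1)) := by simp [map_neg, map_add]
  rw [this, Complex.cpow_conj _ _ harg, Complex.conj_ofReal]

/-! ### D. Poles of a meromorphic function in a compact set are finite -/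

/-- A function meromorphic on `U` is analytic at all but finitely many points of a compact
`K ⊆ U`. (auxiliary step of the proof of Theorem B). [cite: Grosswald1967, §4 Thm B pp. 4–5] -/
theorem finite_compact_nonanalytic {N : ℂ → ℂ} {U K : Set ℂ} (hN : MeromorphicOn N U)
    (hKU : K ⊆ U) (hK : IsCompact K) : (K \ {z | AnalyticAt ℂ N z}).Finite :=
  hK.finite_sdiff_of_mem_codiscreteWithin
    ((Filter.codiscreteWithin_mono hKU) hN.analyticAt_mem_codiscreteWithin)

/-! ### E. Generic real points: no two non-conjugate poles are equidistant -/

/-- Two distinct, non-conjugate points of `ℂ` are equidistant from at most one real point.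
(auxiliary step of the proof of Theorem B). [cite: Grosswald1967, §4 Thm B pp. 4–5] -/
theorem subsingleton_equidist {q q' : ℂ} (h1 : q' ≠ q) (h2 : q' ≠ conj q) :
    ({lam : ℝ | ‖(lam : ℂ) - q‖ = ‖(lam : ℂ) - q'‖}).Subsingleton := by
  intro a ha b hb
  simp only [mem_setOf_eq] at ha hb
  have hsq : ∀ (l : ℝ) (w : ℂ), ‖(l : ℂ) - w‖ ^ 2 = (l - w.re) ^ 2 + w.im ^ 2 := by
    intro l w
    rw [Complex.sq_norm, Complex.normSq_apply]; simp; ring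
  have ha2 : (a - q.re) ^ 2 + q.im ^ 2 = (a - q'.re) ^ 2 + q'.im ^ 2 := by
    rw [← hsq, ← hsq, ha]
  have hb2 : (b - q.re) ^ 2 + q.im ^ 2 = (b - q'.re) ^ 2 + q'.im ^ 2 := by
    rw [← hsq, ← hsq, hb]
  by_contra hab
  have hre : q.re = q'.re := by
    have : (a - b) * (q'.re - q.re) = 0 := by nlinarith
    rcases mul_eq_zero.1 this with h | h
    · exact absurd (sub_eq_zero.1 h) hab
    · linarith [sub_eq_zero.1 h]
  have him : q.im ^ 2 = q'.im ^ 2 := by rw [hre] at ha2; linarith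
  rcases (sq_eq_sq_iff_eq_or_eq_neg.1 him) with h | h
  · exact h1 (Complex.ext hre.symm h.symm)
  · exact h2 (Complex.ext (by simp [hre]) (by simp [h]))

/-- Given finitely many points `Q ⊂ ℂ`, some real `λ ∈ [Λ, Λ+1]` is *generic*: any two points of
`Q` equidistant from `λ` are equal or complex conjugate.
(auxiliary step of the proof of Theorem B). [cite: Grosswald1967, §4 Thm B pp. 4–5] -/
theorem exists_generic_real {Q : Set ℂ} (hQ : Q.Finite) (Λ : ℝ) :
    ∃ lam : ℝ, Λ ≤ lam ∧ lam ≤ Λ + 1 ∧ ∀ q ∈ Q, ∀ q' ∈ Q,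
      ‖(lam : ℂ) - q‖ = ‖(lam : ℂ) - q'‖ → q' = q ∨ q' = conj q := by
  classical
  set B : Set ℝ := ⋃ q ∈ Q, ⋃ q' ∈ Q,
    {lam : ℝ | q' ≠ q ∧ q' ≠ conj q ∧ ‖(lam : ℂ) - q‖ = ‖(lam : ℂ) - q'‖} with hB_def
  have hB : B.Finite := by
    refine hQ.biUnion fun q _ => hQ.biUnion fun q' _ => ?_
    by_cases h : q' ≠ q ∧ q' ≠ conj q
    · refine Set.Finite.subset (subsingleton_equidist h.1 h.2).finite ?_
      intro lam hlam
      exact hlam.2.2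
    · convert Set.finite_empty
      ext lam
      simp only [mem_setOf_eq, mem_empty_iff_false, iff_false]
      tauto
  obtain ⟨lam, hlamI, hlamB⟩ :=
    (Set.Icc_infinite (by linarith : Λ < Λ + 1)).exists_notMem_finite hB
  refine ⟨lam, hlamI.1, hlamI.2, fun q hq q' hq' hd => ?_⟩
  by_contra hcon
  push Not at hcon
  apply hlamB
  simp only [hB_def, mem_iUnion, mem_setOf_eq]
  exact ⟨q, hq, q', hq', hcon.1, hcon.2, hd⟩

/-! ### F. Normal form of the continuation; a pole near the line exists -/

/-- The normal form agrees with `Φ` at every point of `U` where `Φ` is analytic.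
(auxiliary step of the proof of Theorem B). [cite: Grosswald1967, §4 Thm B pp. 4–5] -/
theorem toMeromorphicNFOn_apply_of_analyticAt {Φ : ℂ → ℂ} {U : Set ℂ} (hmer : MeromorphicOn Φ U)
    {z : ℂ} (hz : z ∈ U) (han : AnalyticAt ℂ Φ z) : toMeromorphicNFOn Φ U z = Φ z := by
  rw [toMeromorphicNFOn_eq_toMeromorphicNFAt hmer hz, toMeromorphicNFAt_eq_self.2 han.meromorphicNFAt]

/-- The normal form is analytic wherever `Φ` is analytic on a neighbourhood.
(auxiliary step of the proof of Theorem B). [cite: Grosswald1967, §4 Thm B pp. 4–5] -/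
theorem analyticAt_toMeromorphicNFOn {Φ : ℂ → ℂ} {U : Set ℂ} (hmer : MeromorphicOn Φ U)
    (hU : IsOpen U) {z : ℂ} (hz : z ∈ U) (han : ∀ᶠ w in 𝓝 z, AnalyticAt ℂ Φ w) :
    AnalyticAt ℂ (toMeromorphicNFOn Φ U) z := by
  have hz' : AnalyticAt ℂ Φ z := han.self_of_nhds
  refine hz'.congr ?_
  filter_upwards [han, hU.mem_nhds hz] with w hw hwU
  exact (toMeromorphicNFOn_apply_of_analyticAt hmer hwU hw).symm

/-- At a point of `U` where the normal form is not analytic it has a genuine pole and value `0`.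
(auxiliary step of the proof of Theorem B). [cite: Grosswald1967, §4 Thm B pp. 4–5] -/
theorem toMeromorphicNFOn_pole {Φ : ℂ → ℂ} {U : Set ℂ} {z : ℂ} (hz : z ∈ U)
    (hna : ¬ AnalyticAt ℂ (toMeromorphicNFOn Φ U) z) :
    meromorphicOrderAt (toMeromorphicNFOn Φ U) z < 0 ∧ toMeromorphicNFOn Φ U z = 0 := by
  have h := meromorphicNFOn_toMeromorphicNFOn Φ U hz
  rw [meromorphicNFAt_iff_analyticAt_or] at h
  rcases h with h | h
  · exact absurd h hna
  · exact ⟨h.2.1, h.2.2⟩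

/-- Under the hypotheses of Theorem B the normal form of `Φ` has a pole in every strip
`{θ − η₁ < re}`, `0 < η₁ < ε₀` — otherwise it would continue `F` holomorphically past `θ`.
[cite: Grosswald1967, §4 Thm B pp. 4–5] -/
theorem exists_pole_near_line {g : ℝ → ℝ} {σ₁ θ ε₀ η₁ : ℝ} {Φ : ℂ → ℂ}
    (hθ : θ ≤ σ₁) (hε₀ : 0 < ε₀)
    (hmer : MeromorphicOn Φ {s : ℂ | θ - ε₀ < s.re})
    (hhol : DifferentiableOn ℂ Φ {s : ℂ | θ < s.re})
    (heq : EqOn Φ (Landau.mellinIoi g) {s : ℂ | σ₁ < s.re})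
    (hno : ¬ ∃ Ψ : ℂ → ℂ, DifferentiableOn ℂ Ψ {s : ℂ | θ - η₁ < s.re} ∧
        EqOn Ψ (Landau.mellinIoi g) {s : ℂ | σ₁ < s.re}) :
    ∃ ρ₁ : ℂ, θ - η₁ < ρ₁.re ∧
      ¬ AnalyticAt ℂ (toMeromorphicNFOn Φ {s : ℂ | θ - ε₀ < s.re}) ρ₁ := by
  by_contra h
  push Not at h
  apply hno
  refine ⟨toMeromorphicNFOn Φ {s : ℂ | θ - ε₀ < s.re}, ?_, ?_⟩
  · exact fun s hs => (h s hs).differentiableAt.differentiableWithinAt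
  · intro s hs
    have hsθ : θ < s.re := lt_of_le_of_lt hθ hs
    have hsU : s ∈ {s : ℂ | θ - ε₀ < s.re} := by
      show θ - ε₀ < s.re; linarith
    have han : AnalyticAt ℂ Φ s := hhol.analyticAt ((Landau.isOpen_re_gt θ).mem_nhds hsθ)
    rw [toMeromorphicNFOn_apply_of_analyticAt hmer hsU han]
    exact heq hs

/-! ### G. The conjugate of a nearest pole is a pole -/

/-- Let `N` be in normal form on an open `U`, analytic on `ball λ R` (`λ` real, `R > 0`) and
real-symmetric there (`N = conj ∘ N ∘ conj` on the ball).  If `q ∈ U` with `|λ − q| = R` is a pole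
of `N`, then `N` is not analytic at `conj q` either.
(auxiliary step of the proof of Theorem B). [cite: Grosswald1967, §4 Thm B pp. 4–5] -/
theorem not_analyticAt_conj_of_pole {N : ℂ → ℂ} {U : Set ℂ} (hNF : MeromorphicNFOn N U)
    {lam R : ℝ} (hR : 0 < R) (hsym : EqOn N (fun s => conj (N (conj s))) (ball (lam : ℂ) R))
    {q : ℂ} (hqU : q ∈ U) (hq : ‖(lam : ℂ) - q‖ = R) (hpole : ¬ AnalyticAt ℂ N q) :
    ¬ AnalyticAt ℂ N (conj q) := by
  intro hconj
  set Ns : ℂ → ℂ := fun s => conj (N (conj s)) with hNs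
  -- `Ns` is analytic near `q`
  have hNsq : AnalyticAt ℂ Ns q := AnalyticAt.conj_conj' (by simpa using hconj)
  obtain ⟨δ₁, hδ₁, hδ₁an⟩ : ∃ δ₁ > 0, ∀ z ∈ ball q δ₁, AnalyticAt ℂ Ns z := by
    obtain ⟨δ, hδ, hδt⟩ := Metric.mem_nhds_iff.1 hNsq.eventually_analyticAt
    exact ⟨δ, hδ, fun z hz => hδt hz⟩
  -- `N` is analytic on a punctured neighbourhood of `q`
  have hNq : MeromorphicAt N q := (hNF hqU).meromorphicAt
  obtain ⟨δ₂, hδ₂, hδ₂an⟩ : ∃ δ₂ > 0, ∀ z ∈ ball q δ₂, z ≠ q → AnalyticAt ℂ N z := by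
    have h := hNq.eventually_analyticAt
    rw [eventually_nhdsWithin_iff, Metric.eventually_nhds_iff] at h
    obtain ⟨δ, hδ, hδan⟩ := h
    exact ⟨δ, hδ, fun z hz hzq => hδan hz hzq⟩
  set δ := min δ₁ δ₂ with hδ_def
  have hδ : 0 < δ := lt_min hδ₁ hδ₂
  set W : Set ℂ := ball q δ \ {q} with hW
  have hWpc : IsPreconnected W := isPreconnected_ball_diff_of_countable q δ (countable_singleton q)
  have hNW : AnalyticOnNhd ℂ N W := fun z hz =>
    hδ₂an z (ball_subset_ball (min_le_right _ _) hz.1) hz.2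
  have hNsW : AnalyticOnNhd ℂ Ns W := fun z hz =>
    hδ₁an z (ball_subset_ball (min_le_left _ _) hz.1)
  -- a point of `W` inside `ball λ R`, on the segment from `q` to `λ`
  set t : ℝ := min (1 / 2) (δ / (2 * R)) with ht_def
  have ht0 : 0 < t := lt_min (by norm_num) (by positivity)
  have ht1 : t ≤ 1 / 2 := min_le_left _ _
  have htδ : t * R < δ := by
    have : t ≤ δ / (2 * R) := min_le_right _ _
    calc t * R ≤ δ / (2 * R) * R := mul_le_mul_of_nonneg_right this hR.le
      _ = δ / 2 := by field_simp
      _ < δ := by linarith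
  set z₀ : ℂ := q + (t : ℂ) * ((lam : ℂ) - q) with hz₀
  have hz₀q : ‖z₀ - q‖ = t * R := by
    rw [hz₀, add_sub_cancel_left, norm_mul, Complex.norm_real, Real.norm_eq_abs,
      abs_of_pos ht0, hq]
  have hz₀W : z₀ ∈ W := by
    refine ⟨?_, ?_⟩
    · rw [mem_ball, dist_eq_norm, hz₀q]; exact htδ
    · intro h
      rw [mem_singleton_iff] at h
      have : ‖z₀ - q‖ = 0 := by rw [h, sub_self, norm_zero]
      rw [hz₀q] at this
      exact (mul_pos ht0 hR).ne' this
  have hz₀B : z₀ ∈ ball (lam : ℂ) R := by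
    rw [mem_ball, dist_eq_norm]
    have : z₀ - lam = (1 - (t : ℂ)) * (q - lam) := by rw [hz₀]; ring
    rw [this, norm_mul, show (1 : ℂ) - t = ((1 - t : ℝ) : ℂ) by push_cast; ring, Complex.norm_real,
      Real.norm_eq_abs, abs_of_pos (by linarith), norm_sub_rev, hq]
    nlinarith
  have hev : N =ᶠ[𝓝 z₀] Ns := by
    filter_upwards [isOpen_ball.mem_nhds hz₀B] with z hz
    exact hsym hz
  have hEq : EqOn N Ns W := hNW.eqOn_of_preconnected_of_eventuallyEq hNsW hWpc hz₀W hev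
  -- hence the orders at `q` agree, contradiction
  have hev' : N =ᶠ[𝓝[≠] q] Ns := by
    have hWmem : W ∈ 𝓝[≠] q := by
      rw [hW]
      exact sdiff_mem_nhdsWithin_compl (ball_mem_nhds q hδ) {q}
    filter_upwards [hWmem] with z hz
    exact hEq hz
  have h1 : meromorphicOrderAt N q = meromorphicOrderAt Ns q := meromorphicOrderAt_congr hev'
  have h2 : 0 ≤ meromorphicOrderAt Ns q := hNsq.meromorphicOrderAt_nonneg
  have h3 : meromorphicOrderAt N q < 0 := by
    have h := hNF hqU
    rw [meromorphicNFAt_iff_analyticAt_or] at h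
    rcases h with h | h
    · exact absurd h hpole
    · exact h.2.1
  rw [h1] at h3
  exact absurd h2 (not_le.2 h3)

/-! ### H. Real arithmetic used by the nearest-pole lemma -/

/-- Height bound: a pole at least as close to `λ` as the reference pole `ρ₁`, both with real part
in `(θ − η₁, θ]`, has `γ² ≤ C·λ` with `C = 2η₁ + (2η₁|θ| + 2η₁² + γ₁²)`.
(auxiliary step of the proof of Theorem B). [cite: Grosswald1967, §4 Thm B pp. 4–5] -/
theorem height_bound_of_nearer {lam θ η₁ β γ β₁ γ₁ : ℝ} (h1 : 1 ≤ lam) (hlamθ : θ ≤ lam)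
    (hη₁ : 0 < η₁)
    (hβ : θ - η₁ ≤ β) (hβ' : β ≤ θ) (hβ₁ : θ - η₁ < β₁) (hβ₁' : β₁ ≤ θ)
    (hmin : (lam - β) ^ 2 + γ ^ 2 ≤ (lam - β₁) ^ 2 + γ₁ ^ 2) :
    γ ^ 2 ≤ (2 * η₁ + (2 * η₁ * |θ| + 2 * η₁ ^ 2 + γ₁ ^ 2)) * lam := by
  set u : ℝ := β - β₁ with hu
  set v : ℝ := 2 * lam - β - β₁ with hv
  have hu1 : u ≤ η₁ := by rw [hu]; linarith
  have hv1 : 0 ≤ v := by rw [hv]; linarith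
  have hv2 : v ≤ 2 * lam + 2 * |θ| + 2 * η₁ := by rw [hv]; linarith [neg_abs_le θ]
  have h2 : γ ^ 2 ≤ u * v + γ₁ ^ 2 := by
    have : (lam - β₁) ^ 2 - (lam - β) ^ 2 = u * v := by rw [hu, hv]; ring
    linarith
  have h3 : u * v ≤ η₁ * (2 * lam + 2 * |θ| + 2 * η₁) :=
    le_trans (mul_le_mul_of_nonneg_right hu1 hv1) (mul_le_mul_of_nonneg_left hv2 hη₁.le)
  have h4 : 0 ≤ 2 * η₁ * |θ| + 2 * η₁ ^ 2 + γ₁ ^ 2 := by positivity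
  nlinarith

/-- The reference pole lies in the open disc `|s − λ| < λ − θ + η₁` once `λ` is large.
(auxiliary step of the proof of Theorem B). [cite: Grosswald1967, §4 Thm B pp. 4–5] -/
theorem ref_pole_in_disc {lam θ η₁ β₁ γ₁ : ℝ} (hc₁ : 0 < β₁ - θ + η₁)
    (hlam : β₁ + γ₁ ^ 2 / (2 * (β₁ - θ + η₁)) + 1 ≤ lam) :
    (lam - β₁) ^ 2 + γ₁ ^ 2 < (lam - θ + η₁) ^ 2 := by
  set c₁ := β₁ - θ + η₁ with hc₁_def
  have h1 : γ₁ ^ 2 / (2 * c₁) ≤ lam - β₁ - 1 := by linarith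
  have h2 : γ₁ ^ 2 ≤ 2 * c₁ * (lam - β₁ - 1) := by
    rw [div_le_iff₀ (by positivity)] at h1; linarith
  have : lam - θ + η₁ = (lam - β₁) + c₁ := by rw [hc₁_def]; ring
  rw [this]
  nlinarith

end Literature.NumberTheory.LFunctions.PolyaSignChanges

end
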